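import Summits.KontsevichZagierPeriods.KontsevichZagierPeriods.Theorems.HurwitzMicroSectorsNormalFormPrincipleBoxSplitCertK8
import Literature.NumberTheory.Transcendental.KZCubeRationalMoves

/-!
# `ReductionRigidity` (stmt-KontsevichZagierPeriods-3407), line `Sketch`, stub `stub_islandComplement`:
# the UNCONDITIONAL multi-level weight-one island (`stub_multiLevelLineKernel`)

Route `KontsevichZagierPeriods/HermiteRigidity`, crux `ReductionRigidity` (stmt-3407); island-growth
deliverable G1 of `Cruxes/ReductionRigidity/STUB-PLAN-stub_islandComplement.md` for the remainder stub
`stub_islandComplement` (= item stmt-15935 `IslandComplement`, certified summit-strength in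
`HermiteRigidityIslandComplementStrength.lean`). The stub's hypothesis (i) is the kernel form of
Conjecture 1 on the weight-one line sector LEVEL BY LEVEL; this file proves the kernel form on the
MULTI-LEVEL weight-one sector, all integer levels `N ≥ 2` at once:

  `S = {[□¹, x^a/(N − x)^m] : N ≥ 2, a, m ∈ ℕ} ∪ {[pt, q] : q ∈ ℚ}`,
  `∀ c ∈ closure S, eval c = 0 → c ∈ KZ.relations`                    (`stub_multiLevelLineKernel`).

Cross-level kernel elements such as `[□¹, 1/(9−x)] − 2[□¹, 1/(3−x)] + [□¹, 1/(2−x)]`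
(`log(9/8) = 2 log(3/2) − log 2`) are invisible to every single-level island and are covered here.

Mechanism (no new moves): every element of `closure S` is congruent modulo `KZ.relations` to ONE
closed-interval representation `[□¹, p/q]` of a regular rational function whose denominator
`q = ∏ᵢ (Nᵢ − X)^{mᵢ}` SPLITS over `ℚ` and does not vanish on `[0,1]` (closure induction with the
side-condition-free cube kit `KZ.RFun`: `rel_add`, `rel_neg`, `rel_lift`, congruence); the closed
interval is traded for the open slab `(0,1)` across its two null endpoints (rule 1a,
`KZ.IntegralRep.of_sub_of_restrict_mem_relations`); and a slab representation `[(0,1), p/q]` of value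
`0` with `ℚ`-split denominator is a relation by the LANDED BoxVanishing certificate
`BoxSplitCertificate.box_split_mem_relations` (HurwitzMicroSectors / NormalFormPrinciple: partial
fractions, Newton–Leibniz, affine and scaling moves, prime carriers, and the finite core decided by
Hermite–Lindemann + unique factorisation).

References: M. Kontsevich, D. Zagier, *Periods* (2001), §1.2 [cite: KontsevichZagier2001, §1.2].
No definitions are introduced (the presentation predicate is written out as an `∃`).
-/

noncomputable section

open MeasureTheory Set MvPolynomial
open scoped Polynomial

namespace Summit.KontsevichZagierPeriods.HermiteRigidity.ReductionRigidity

open Literature.NumberTheory.Transcendental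
open Literature.NumberTheory.Transcendental.KZ
open Literature.ModelTheory.ExponentialFields (IsSemialgebraic)
open Literature.NumberTheory.Transcendental.KZ.BallPeeling (isSemialgebraic_Ioo₁)
open Summit.KontsevichZagierPeriods.HurwitzMicroSectors.NormalFormPrinciple.PiBox.Dlog
  (volume_slab exists_rep_unit)
open Summit.KontsevichZagierPeriods.HurwitzMicroSectors.NormalFormPrinciple.PiBox.Dlog.BoxSplitCertificate
  (box_split_mem_relations)

/-! ## Univariate polynomials read on the first coordinate of `ℝ¹` -/

/-- Reading `A ∈ ℚ[X]` as the `1`-variable polynomial `A(X₀)`: evaluation at `x ∈ ℝ¹` is `A(x₀)`.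
[folklore] -/
theorem mvAeval_polynomialAeval_X (x : Fin 1 → ℝ) (A : ℚ[X]) :
    MvPolynomial.aeval x (Polynomial.aeval (X 0 : MvPolynomial (Fin 1) ℚ) A) =
      (Polynomial.aeval (x 0) A : ℝ) := by
  rw [← Polynomial.aeval_algHom_apply, MvPolynomial.aeval_X]

/-- A point of the closed unit interval `□¹` has first coordinate in `[0,1]`. [folklore] -/
theorem mem_Icc_of_mem_cube_one {x : Fin 1 → ℝ} (hx : x ∈ cube 1) : x 0 ∈ Set.Icc (0:ℝ) 1 :=
  ⟨(hx 0).1, (hx 0).2⟩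

/-- **The regular rational function `p/q` on `□¹`** for `p, q ∈ ℚ[X]` with `q ≠ 0` on `[0,1]`: some
`T : KZ.RFun 1` takes the values `p(x₀)/q(x₀)` on the closed interval. [cite: KontsevichZagier2001, §1.1] -/
theorem exists_rfun_of_polynomial_div (p q : ℚ[X])
    (hq01 : ∀ t ∈ Set.Icc (0:ℝ) 1, (Polynomial.aeval t q : ℝ) ≠ 0) :
    ∃ T : RFun 1, ∀ x ∈ cube 1,
      T.fn x = (Polynomial.aeval (x 0) p : ℝ) / Polynomial.aeval (x 0) q := by
  refine ⟨⟨Polynomial.aeval (X 0 : MvPolynomial (Fin 1) ℚ) p,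
    Polynomial.aeval (X 0 : MvPolynomial (Fin 1) ℚ) q, fun x hx => ?_⟩, fun x _ => ?_⟩
  · rw [mvAeval_polynomialAeval_X]
    exact hq01 _ (mem_Icc_of_mem_cube_one hx)
  · rw [RFun.fn_apply, mvAeval_polynomialAeval_X, mvAeval_polynomialAeval_X]

/-! ## Closed interval versus open slab, and the BoxVanishing certificate -/

/-- **Closed interval versus open slab** (rule 1a across the two null endpoints, then congruence):
for a regular rational function `T` on `□¹` and any representation `N` on the open slab `(0,1)` whose
integrand agrees with `T` there, `[□¹, T] − [N] ∈ KZ.relations`. [cite: KontsevichZagier2001, §1.2 rule (1)] -/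
theorem of_rep_sub_of_slab_mem_relations (T : RFun 1) (N : IntegralRep 1)
    (hNd : N.domain = {x | x 0 ∈ Set.Ioo (0:ℝ) 1})
    (hNi : ∀ x ∈ N.domain, N.integrand x = T.fn x) :
    KZ.of T.rep - KZ.of N ∈ KZ.relations := by
  have hE : IsSemialgebraic ℚ {x : Fin 1 → ℝ | x 0 ∈ Set.Ioo (0:ℝ) 1} := by
    simpa using isSemialgebraic_Ioo₁ 0 1
  have hEsub : {x : Fin 1 → ℝ | x 0 ∈ Set.Ioo (0:ℝ) 1} ⊆ T.rep.domain := by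
    intro x hx i
    rw [Fin.fin_one_eq_zero i]
    exact ⟨hx.1.le, hx.2.le⟩
  have hvol : volume (T.rep.domain \ {x : Fin 1 → ℝ | x 0 ∈ Set.Ioo (0:ℝ) 1}) = 0 := by
    refine measure_mono_null (t := {z : Fin 1 → ℝ | z 0 ∈ ({0, 1} : Set ℝ)}) ?_ ?_
    · rintro x ⟨hx, hx'⟩
      have h0 : 0 ≤ x 0 ∧ x 0 ≤ 1 := hx 0
      simp only [mem_setOf_eq, mem_Ioo, not_and, not_lt, mem_insert_iff, mem_singleton_iff] at hx' ⊢
      rcases h0.1.eq_or_lt with h | h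
      · exact Or.inl h.symm
      · exact Or.inr (le_antisymm h0.2 (hx' h))
    · rw [volume_slab]
      exact (Set.toFinite _).measure_zero _
  have h1 := KZ.IntegralRep.of_sub_of_restrict_mem_relations T.rep hE hEsub hvol
  have h2 : KZ.of (T.rep.restrict _ hE hEsub) - KZ.of N ∈ KZ.relations :=
    KZ.of_sub_of_mem_relations_of_eqOn (by rw [hNd]; rfl) fun x hx =>
      (hNi x (by rw [hNd]; exact hx)).symm
  have : KZ.of T.rep - KZ.of N =
      (KZ.of T.rep - KZ.of (T.rep.restrict _ hE hEsub)) +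
        (KZ.of (T.rep.restrict _ hE hEsub) - KZ.of N) := by abel
  rw [this]
  exact KZ.relations.add_mem h1 h2

/-- **BoxVanishing on the closed interval for `ℚ`-split denominators** (transport of the landed
`BoxSplitCertificate.box_split_mem_relations` from the open slab to the cube representation): if
`T : KZ.RFun 1` takes the values `p/q` on `□¹` with `q ∈ ℚ[X]` split over `ℚ` and non-vanishing on
`[0,1]`, and `[□¹, T]` has value `0`, then `[□¹, T] ∈ KZ.relations`.
[cite: KontsevichZagier2001, §1.2 Conjecture 1 (this sub-family)] -/
theorem of_rep_mem_relations_of_split (p q : ℚ[X]) (hsplit : q.Splits)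
    (hq01 : ∀ t ∈ Set.Icc (0:ℝ) 1, (Polynomial.aeval t q : ℝ) ≠ 0) (T : RFun 1)
    (hT : ∀ x ∈ cube 1, T.fn x = (Polynomial.aeval (x 0) p : ℝ) / Polynomial.aeval (x 0) q)
    (hv : KZ.eval (KZ.of T.rep) = 0) : KZ.of T.rep ∈ KZ.relations := by
  have hq : q ≠ 0 := fun h => hq01 0 ⟨le_rfl, zero_le_one⟩ (by simp [h])
  obtain ⟨N, hNd, hNi⟩ := exists_rep_unit p q hq01
  have hTN : KZ.of T.rep - KZ.of N ∈ KZ.relations := by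
    refine of_rep_sub_of_slab_mem_relations T N hNd fun x hx => ?_
    rw [hNd] at hx
    have hx' : x ∈ cube 1 := fun i => by
      rw [Fin.fin_one_eq_zero i]; exact ⟨hx.1.le, hx.2.le⟩
    rw [hNi, hT x hx']
  have hval : N.value = 0 := by
    have h0 : KZ.eval (KZ.of T.rep - KZ.of N) = 0 :=
      (AddMonoidHom.mem_ker).1 (relations_le_ker_eval_holds hTN)
    rwa [map_sub, hv, zero_sub, neg_eq_zero, eval_of] at h0
  have hN : KZ.of N ∈ KZ.relations :=
    box_split_mem_relations p q hq hsplit hq01 N hNd (fun x _ => by rw [hNi]) hval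
  have : KZ.of T.rep = (KZ.of T.rep - KZ.of N) + KZ.of N := by abel
  rw [this]
  exact KZ.relations.add_mem hTN hN

/-! ## The presentation: every element of the closure is `≡ [□¹, p/q]` with `q` split -/

/-- **Generators are presented, (a) the line generators**: `[□¹, x^a/(N − x)^m] ≡ [□¹, X^a/(N − X)^m]`
with `(C N − X)^m` split over `ℚ` and `≥ 1` on `[0,1]` (`N ≥ 2`); the given representation is any
representation with domain `□¹` and that integrand on it (congruence, rule 1b).
[cite: KontsevichZagier2001, §1.2 rule (1)] -/
theorem presented_lineGen {N : ℕ} (hN : 2 ≤ N) (a m : ℕ) (r : IntegralRep 1)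
    (hr : r.domain = cube 1)
    (hri : EqOn r.integrand (fun p => p 0 ^ a / ((N : ℝ) - p 0) ^ m) (cube 1)) :
    ∃ (p q : ℚ[X]) (T : RFun 1), q.Splits ∧
      (∀ t ∈ Set.Icc (0:ℝ) 1, (Polynomial.aeval t q : ℝ) ≠ 0) ∧
      (∀ x ∈ cube 1, T.fn x = (Polynomial.aeval (x 0) p : ℝ) / Polynomial.aeval (x 0) q) ∧
      KZ.of r - KZ.of T.rep ∈ KZ.relations := by
  have h2 : (2:ℝ) ≤ (N:ℝ) := by exact_mod_cast hN
  have hq01 : ∀ t ∈ Set.Icc (0:ℝ) 1,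
      (Polynomial.aeval t ((Polynomial.C (N:ℚ) - Polynomial.X) ^ m) : ℝ) ≠ 0 := by
    intro t ht
    simp only [map_pow, map_sub, Polynomial.aeval_C, Polynomial.aeval_X, eq_ratCast,
      Rat.cast_natCast]
    exact pow_ne_zero _ (by linarith [ht.2])
  obtain ⟨T, hT⟩ := exists_rfun_of_polynomial_div (Polynomial.X ^ a)
    ((Polynomial.C (N:ℚ) - Polynomial.X) ^ m) hq01
  refine ⟨Polynomial.X ^ a, (Polynomial.C (N:ℚ) - Polynomial.X) ^ m, T, ?_, hq01, hT, ?_⟩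
  · rw [← neg_sub]
    exact ((Polynomial.Splits.X_sub_C _).neg).pow m
  · refine KZ.of_sub_of_mem_relations_of_eqOn (by rw [hr]; rfl) fun x hx => ?_
    rw [hr] at hx
    rw [hri hx]
    show x 0 ^ a / ((N : ℝ) - x 0) ^ m = T.fn x
    rw [hT x hx]
    simp only [map_pow, map_sub, Polynomial.aeval_C, Polynomial.aeval_X, eq_ratCast,
      Rat.cast_natCast]

/-- **Generators are presented, (b) the rational constants**: `[pt, q] ≡ [□¹, (C q)/1]` (congruence
in dimension `0`, then ignoring a variable, `KZ.RFun.rel_lift`, one Stokes move).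
[cite: KontsevichZagier2001, §1.2 rules (1), (3)] -/
theorem presented_const (q₀ : ℚ) (r : IntegralRep 0) (hr : r.domain = cube 0)
    (hri : EqOn r.integrand (fun _ => (q₀ : ℝ)) (cube 0)) :
    ∃ (p q : ℚ[X]) (T : RFun 1), q.Splits ∧
      (∀ t ∈ Set.Icc (0:ℝ) 1, (Polynomial.aeval t q : ℝ) ≠ 0) ∧
      (∀ x ∈ cube 1, T.fn x = (Polynomial.aeval (x 0) p : ℝ) / Polynomial.aeval (x 0) q) ∧
      KZ.of r - KZ.of T.rep ∈ KZ.relations := by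
  refine ⟨Polynomial.C q₀, 1, (RFun.const q₀ : RFun 0).lift, Polynomial.Splits.one,
    fun t _ => by simp, fun x _ => ?_, ?_⟩
  · rw [RFun.fn_lift, RFun.fn_const]
    simp
  · have e1 : KZ.of r - KZ.of (RFun.const q₀ : RFun 0).rep ∈ KZ.relations := by
      refine KZ.of_sub_of_mem_relations_of_eqOn (by rw [hr]; rfl) fun x hx => ?_
      rw [hr] at hx
      rw [hri hx]
      show (q₀ : ℝ) = (RFun.const q₀ : RFun 0).fn x
      rw [RFun.fn_const]
    have e2 := RFun.rel_lift (RFun.const q₀ : RFun 0)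
    have : KZ.of r - KZ.of (RFun.const q₀ : RFun 0).lift.rep =
        (KZ.of r - KZ.of (RFun.const q₀ : RFun 0).rep) -
          (KZ.of (RFun.const q₀ : RFun 0).lift.rep - KZ.of (RFun.const q₀ : RFun 0).rep) := by
      abel
    rw [this]
    exact KZ.relations.sub_mem e1 e2

/-- **Presentations are closed under the group operations**: zero (`[□¹, 0/1]` is a relation),
addition (`[□¹, p₁/q₁] + [□¹, p₂/q₂] ≡ [□¹, (p₁q₂ + p₂q₁)/(q₁q₂)]`, rule 1b via `KZ.RFun.rel_add`;
`q₁q₂` splits, `Polynomial.Splits.mul`) and negation (`−[□¹, p/q] ≡ [□¹, (−p)/q]`,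
`KZ.RFun.rel_neg`). [cite: KontsevichZagier2001, §1.2 rule (1)] -/
theorem presented_closed :
    (∃ (p q : ℚ[X]) (T : RFun 1), q.Splits ∧
      (∀ t ∈ Set.Icc (0:ℝ) 1, (Polynomial.aeval t q : ℝ) ≠ 0) ∧
      (∀ x ∈ cube 1, T.fn x = (Polynomial.aeval (x 0) p : ℝ) / Polynomial.aeval (x 0) q) ∧
      (0 : FormalRep) - KZ.of T.rep ∈ KZ.relations) ∧
    (∀ c₁ c₂ : FormalRep,
      (∃ (p q : ℚ[X]) (T : RFun 1), q.Splits ∧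
        (∀ t ∈ Set.Icc (0:ℝ) 1, (Polynomial.aeval t q : ℝ) ≠ 0) ∧
        (∀ x ∈ cube 1, T.fn x = (Polynomial.aeval (x 0) p : ℝ) / Polynomial.aeval (x 0) q) ∧
        c₁ - KZ.of T.rep ∈ KZ.relations) →
      (∃ (p q : ℚ[X]) (T : RFun 1), q.Splits ∧
        (∀ t ∈ Set.Icc (0:ℝ) 1, (Polynomial.aeval t q : ℝ) ≠ 0) ∧
        (∀ x ∈ cube 1, T.fn x = (Polynomial.aeval (x 0) p : ℝ) / Polynomial.aeval (x 0) q) ∧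
        c₂ - KZ.of T.rep ∈ KZ.relations) →
      ∃ (p q : ℚ[X]) (T : RFun 1), q.Splits ∧
        (∀ t ∈ Set.Icc (0:ℝ) 1, (Polynomial.aeval t q : ℝ) ≠ 0) ∧
        (∀ x ∈ cube 1, T.fn x = (Polynomial.aeval (x 0) p : ℝ) / Polynomial.aeval (x 0) q) ∧
        (c₁ + c₂) - KZ.of T.rep ∈ KZ.relations) ∧
    (∀ c : FormalRep,
      (∃ (p q : ℚ[X]) (T : RFun 1), q.Splits ∧
        (∀ t ∈ Set.Icc (0:ℝ) 1, (Polynomial.aeval t q : ℝ) ≠ 0) ∧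
        (∀ x ∈ cube 1, T.fn x = (Polynomial.aeval (x 0) p : ℝ) / Polynomial.aeval (x 0) q) ∧
        c - KZ.of T.rep ∈ KZ.relations) →
      ∃ (p q : ℚ[X]) (T : RFun 1), q.Splits ∧
        (∀ t ∈ Set.Icc (0:ℝ) 1, (Polynomial.aeval t q : ℝ) ≠ 0) ∧
        (∀ x ∈ cube 1, T.fn x = (Polynomial.aeval (x 0) p : ℝ) / Polynomial.aeval (x 0) q) ∧
        (-c) - KZ.of T.rep ∈ KZ.relations) := by
  refine ⟨?_, ?_, ?_⟩
  · -- zero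
    obtain ⟨T, hT⟩ := exists_rfun_of_polynomial_div 0 1 fun t _ => by simp
    refine ⟨0, 1, T, Polynomial.Splits.one, fun t _ => by simp, hT, ?_⟩
    rw [zero_sub]
    exact KZ.relations.neg_mem (RFun.rel_of_eqOn_zero fun x hx => by rw [hT x hx]; simp)
  · -- addition
    rintro c₁ c₂ ⟨p₁, q₁, T₁, hs₁, hq₁, hT₁, hc₁⟩ ⟨p₂, q₂, T₂, hs₂, hq₂, hT₂, hc₂⟩
    refine ⟨p₁ * q₂ + p₂ * q₁, q₁ * q₂, T₁.add T₂, hs₁.mul hs₂, fun t ht => ?_, fun x hx => ?_, ?_⟩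
    · rw [map_mul]
      exact mul_ne_zero (hq₁ t ht) (hq₂ t ht)
    · have h₁ := hq₁ _ (mem_Icc_of_mem_cube_one hx)
      have h₂ := hq₂ _ (mem_Icc_of_mem_cube_one hx)
      rw [RFun.fn_add hx, hT₁ x hx, hT₂ x hx]
      simp only [map_add, map_mul]
      field_simp
    · have e := RFun.rel_add T₁ T₂
      have : c₁ + c₂ - KZ.of (T₁.add T₂).rep =
          (c₁ - KZ.of T₁.rep) + (c₂ - KZ.of T₂.rep) -
            (KZ.of (T₁.add T₂).rep - KZ.of T₁.rep - KZ.of T₂.rep) := by abel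
      rw [this]
      exact KZ.relations.sub_mem (KZ.relations.add_mem hc₁ hc₂) e
  · -- negation
    rintro c ⟨p, q, T, hs, hq, hT, hc⟩
    refine ⟨-p, q, T.neg, hs, hq, fun x hx => ?_, ?_⟩
    · rw [RFun.fn_neg, hT x hx, map_neg, neg_div]
    · have e := RFun.rel_neg T
      have : -c - KZ.of T.neg.rep = -(c - KZ.of T.rep) - (KZ.of T.neg.rep + KZ.of T.rep) := by abel
      rw [this]
      exact KZ.relations.sub_mem (KZ.relations.neg_mem hc) e

/-- **Every element of the multi-level line closure is presented** by one cube representation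
`[□¹, p/q]` with `q` split over `ℚ` and non-vanishing on `[0,1]` (closure induction over
`presented_lineGen`, `presented_const`, `presented_closed`). [cite: KontsevichZagier2001, §1.2] -/
theorem presented_of_mem_closure (c : FormalRep)
    (hc : c ∈ AddSubgroup.closure
      ({c : FormalRep | ∃ (N : ℕ) (r : IntegralRep 1) (a m : ℕ), 2 ≤ N ∧ r.domain = cube 1 ∧
          EqOn r.integrand (fun p => p 0 ^ a / ((N : ℝ) - p 0) ^ m) (cube 1) ∧ c = KZ.of r} ∪
       {c | ∃ (r : IntegralRep 0) (q : ℚ), r.domain = cube 0 ∧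
          EqOn r.integrand (fun _ => (q : ℝ)) (cube 0) ∧ c = KZ.of r})) :
    ∃ (p q : ℚ[X]) (T : RFun 1), q.Splits ∧
      (∀ t ∈ Set.Icc (0:ℝ) 1, (Polynomial.aeval t q : ℝ) ≠ 0) ∧
      (∀ x ∈ cube 1, T.fn x = (Polynomial.aeval (x 0) p : ℝ) / Polynomial.aeval (x 0) q) ∧
      c - KZ.of T.rep ∈ KZ.relations := by
  induction hc using AddSubgroup.closure_induction with
  | mem x hx =>
    rcases hx with ⟨N, r, a, m, hN, hr, hri, rfl⟩ | ⟨r, q₀, hr, hri, rfl⟩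
    · exact presented_lineGen hN a m r hr hri
    · exact presented_const q₀ r hr hri
  | zero => exact presented_closed.1
  | add x y _ _ hx hy => exact presented_closed.2.1 x y hx hy
  | neg x _ hx => exact presented_closed.2.2 x hx

/-! ## The registered sub-goal stub -/

/-- **Stub `stub_multiLevelLineKernel`** (sub-goal of crux `ReductionRigidity`, stmt-3407, line `Sketch`,
growth deliverable G1 for the remainder stub `stub_islandComplement`): **Conjecture 1 in kernel form
on the MULTI-LEVEL weight-one box sector**, unconditionally. For every formal `ℤ`-combination `c` of
the representations `[□¹, x^a/(N − x)^m]` (all integer levels `N ≥ 2` at once) and the rational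
constants `[pt, q]`: if `eval c = 0` then `c ∈ KZ.relations`. Proof: `c ≡ [□¹, p/q]` with `q` split
(`presented_of_mem_closure`), `[□¹, p/q]` has value `eval c = 0` by soundness, and is a relation by
the BoxVanishing certificate (`of_rep_mem_relations_of_split`). This strictly enlarges hypothesis (i)
of `stub_islandComplement` (which is level by level). [cite: KontsevichZagier2001, §1.2 Conjecture 1 (this sub-family)] -/
theorem stub_multiLevelLineKernel :
    ∀ c ∈ AddSubgroup.closure
      ({c : FormalRep | ∃ (N : ℕ) (r : IntegralRep 1) (a m : ℕ), 2 ≤ N ∧ r.domain = cube 1 ∧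
          EqOn r.integrand (fun p => p 0 ^ a / ((N : ℝ) - p 0) ^ m) (cube 1) ∧ c = KZ.of r} ∪
       {c | ∃ (r : IntegralRep 0) (q : ℚ), r.domain = cube 0 ∧
          EqOn r.integrand (fun _ => (q : ℝ)) (cube 0) ∧ c = KZ.of r}),
      KZ.eval c = 0 → c ∈ KZ.relations := by
  intro c hc h0
  obtain ⟨p, q, T, hsplit, hq01, hT, hcT⟩ := presented_of_mem_closure c hc
  have hv : KZ.eval (KZ.of T.rep) = 0 := by
    have h := (AddMonoidHom.mem_ker).1 (relations_le_ker_eval_holds hcT)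
    rwa [map_sub, h0, zero_sub, neg_eq_zero] at h
  have hT0 : KZ.of T.rep ∈ KZ.relations := of_rep_mem_relations_of_split p q hsplit hq01 T hT hv
  have : c = (c - KZ.of T.rep) + KZ.of T.rep := by abel
  rw [this]
  exact KZ.relations.add_mem hcT hT0

/-- **Corollary: hypothesis (i) of `stub_islandComplement`, level by level, from the multi-level
island** (monotonicity of the closure). This is the first conjunct of `PadeBoxIslands` (stmt-15909,
already proved by the line reduction + Baker); here it is re-derived from the multi-level theorem, whose
arithmetic input is only Hermite–Lindemann + unique factorisation. [cite: KontsevichZagier2001, §1.2] -/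
theorem lineKernel_of_multiLevel (N : ℕ) (hN : 2 ≤ N) :
    ∀ c ∈ AddSubgroup.closure
      ({c : FormalRep | ∃ (r : IntegralRep 1) (a m : ℕ), r.domain = cube 1 ∧
          EqOn r.integrand (fun p => p 0 ^ a / ((N : ℝ) - p 0) ^ m) (cube 1) ∧ c = KZ.of r} ∪
       {c | ∃ (r : IntegralRep 0) (q : ℚ), r.domain = cube 0 ∧
          EqOn r.integrand (fun _ => (q : ℝ)) (cube 0) ∧ c = KZ.of r}),
      KZ.eval c = 0 → c ∈ KZ.relations := by
  intro c hc h0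
  refine stub_multiLevelLineKernel c (AddSubgroup.closure_mono ?_ hc) h0
  rintro x (⟨r, a, m, hr, hri, rfl⟩ | hx)
  · exact Or.inl ⟨N, r, a, m, hN, hr, hri, rfl⟩
  · exact Or.inr hx

end Summit.KontsevichZagierPeriods.HermiteRigidity.ReductionRigidity

end
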